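import Literature.Analysis.FluidPDE.EulerFlowsScalarAnomalousDissipation
import Literature.Analysis.FluidPDE.TurbPassiveScalarProofs
import HarnessLib

/-!
# Burczak–Székelyhidi–Wu 2023: proved bookkeeping for `EulerFlowsScalarAnomalousDissipation.lean`

Companion (theorems only, no new statements) to the statement-only file
`Literature/Analysis/FluidPDE/EulerFlowsScalarAnomalousDissipation.lean` (Burczak–Székelyhidi–Wu,
*Anomalous dissipation and Euler flows*, arXiv:2310.02934v2). Contents, all proved:

* API of `Torus.HasScalarAnomalousDissipationAlong`: `.pos`, `.tendsto`, and `.not_tendsto_zero` —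
  along the sequence the cumulative dissipations of ANY choice of weak solutions with a fixed
  non-zero mean-zero `H¹` datum do not tend to `0` (the negation of the "no anomalous dissipation"
  conclusion in the form used by `Barriers.AnomalousDissipation.DrivasElgindiIyerJeong2022_thm4`).
* `Torus.subsolutionEnergy_zero_smul_id`: the energy (2.65) of the trivial subsolution
  `(0, 0, (e/d) Id)` is `e` (p. 19); `Torus.IsSmoothStrictEulerSubsolutionOn.isSmooth_slice`.
* `Torus.isSmoothStrictEulerSubsolutionOn_zero_third_id`: `(0, 0, ⅓ Id)` IS a smooth strict
  subsolution on `T³` (non-vacuity of the structure; the triple of the proof of Thm. 1.1, p. 19).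
* `BurczakSzekelyhidiWu2023_thm11_of_thm31`: Thm. 3.1 ⇒ Thm. 1.1, the derivation printed on p. 19.
* `BurczakSzekelyhidiWu2023_thm11_of_strongDensity`: strong density with `ū = 0` ⇒ Thm. 1.1.
* `BurczakSzekelyhidiWu2023_thm11_of_richardsonBound` (2026-08-26): the explicit data-uniform
  bound (1.5) of §1.2 ⇒ Thm. 1.1 — every non-zero mean-zero `H¹` datum has a length scale
  `ℓ_in = ‖ρ_in‖_{L²}/‖∇ρ_in‖_{L²} > 0` (`Torus.exists_lengthScale`, spectral Poincaré), at which
  (1.5) gives the per-datum constant `c₀ = c_ε min{ℓ_in^{2p_ε-2} T^{p_ε}, ℓ_in^{2ε}} > 0` of (1.4)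
  (p. 2: "the statement of Theorem 1.1 holds with constant `c₀` satisfying (1.5)").

## References

* J. Burczak, L. Székelyhidi Jr., B. Wu, arXiv:2310.02934v2 (2024), Thm. 1.1 (p. 2), §2.2 (2.27)
  (p. 11), §2.3 (2.65) (p. 17), Thm. 3.1 (pp. 18–19), proof of Thm. 1.1 (p. 19).
  [`BurczakSzekelyhidiWu2023`]
-/

open MeasureTheory Set Filter Topology
open scoped InnerProductSpace ENNReal NNReal

noncomputable section

namespace Literature.Analysis.FluidPDE

namespace Torus

/-- The diffusivities of `HasScalarAnomalousDissipationAlong` are positive (`κ_q = λ_q^{-θ} > 0`, (2.27)). [cite: BurczakSzekelyhidiWu2023, §2.2 (2.27) p. 11] -/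
theorem HasScalarAnomalousDissipationAlong.pos {T₀ : ℝ}
    {u : ℝ → UnitAddTorus (Fin 3) → EuclideanSpace ℝ (Fin 3)} {κ : ℕ → ℝ}
    (h : HasScalarAnomalousDissipationAlong T₀ u κ) (q : ℕ) : 0 < κ q :=
  h.1 q

/-- The diffusivities of `HasScalarAnomalousDissipationAlong` tend to zero (`κ_q = λ_q^{-θ} → 0`, (2.27)). [cite: BurczakSzekelyhidiWu2023, §2.2 (2.27) p. 11] -/
theorem HasScalarAnomalousDissipationAlong.tendsto {T₀ : ℝ}
    {u : ℝ → UnitAddTorus (Fin 3) → EuclideanSpace ℝ (Fin 3)} {κ : ℕ → ℝ}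
    (h : HasScalarAnomalousDissipationAlong T₀ u κ) : Tendsto κ atTop (𝓝 0) :=
  h.2.1

/-- **No vanishing of the dissipation along the sequence**: under
`HasScalarAnomalousDissipationAlong T₀ u κ`, for a non-zero mean-zero `H¹` datum, `T ∈ (0,T₀]` and
ANY choice of weak solutions `θ_q` (diffusivity `κ_q`, datum `θ₀`, window `[0,T₀)`), the cumulative
dissipations `κ_q ∫₀ᵀ ‖∇θ_q‖²` do not tend to `0` — the negation of the "no anomalous dissipation"
conclusion in the form used by `Barriers.AnomalousDissipation.DrivasElgindiIyerJeong2022_thm4`.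
[cite: BurczakSzekelyhidiWu2023, Thm. 1.1 (1.4) p. 2] -/
theorem HasScalarAnomalousDissipationAlong.not_tendsto_zero {T₀ : ℝ}
    {u : ℝ → UnitAddTorus (Fin 3) → EuclideanSpace ℝ (Fin 3)} {κ : ℕ → ℝ}
    (h : HasScalarAnomalousDissipationAlong T₀ u κ) {θ₀ : UnitAddTorus (Fin 3) → ℝ}
    (hθ₀ : FunctionSpaces.Torus.MemSobolev 1 (fun x => (θ₀ x : ℂ)))
    (hmean : FunctionSpaces.Torus.HasZeroMean θ₀) (hpos : 0 < scalarL2Sq θ₀)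
    {T : ℝ} (hT : 0 < T) (hTT₀ : T ≤ T₀) {θ : ℕ → ℝ → UnitAddTorus (Fin 3) → ℝ}
    (hθ : ∀ q, IsWeakScalarTransportOn T₀ (κ q) u θ₀ (θ q)) :
    ¬ Tendsto (fun q => eScalarDissipation (κ q) (θ q) 0 T) atTop (𝓝 0) := by
  obtain ⟨c, hc, hev⟩ := h.2.2 θ₀ hθ₀ hmean hpos T hT hTT₀
  intro hlim
  have hcpos : (0 : ℝ≥0∞) < ENNReal.ofReal (c * scalarL2Sq θ₀) :=
    ENNReal.ofReal_pos.mpr (mul_pos hc hpos)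
  have hsmall : ∀ᶠ q in atTop, eScalarDissipation (κ q) (θ q) 0 T < ENNReal.ofReal (c * scalarL2Sq θ₀) :=
    hlim.eventually (Iio_mem_nhds hcpos)
  obtain ⟨q, hq₁, hq₂⟩ := (hev.and hsmall).exists
  exact absurd (hq₁ (θ q) (hθ q)) (not_le.mpr hq₂)

variable {d : Type*} [Fintype d] [DecidableEq d]

/-- For the trivial subsolution `ū = 0`, `R̄(t,x) = (e(t)/d) Id` (the one used to derive Thm. 1.1
from Thm. 3.1, p. 19, there with `d = 3`) the energy is `e(t)`. [cite: BurczakSzekelyhidiWu2023, proof of Thm. 1.1 p. 19] -/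
theorem subsolutionEnergy_zero_smul_id [Nonempty d] (e : ℝ → ℝ) (t : ℝ) :
    subsolutionEnergy (fun (_ : ℝ) (_ : UnitAddTorus d) => (0 : EuclideanSpace ℝ d))
      (fun t _ j => (e t / Fintype.card d) • EuclideanSpace.single j (1 : ℝ)) t = e t := by
  have hcard : (Fintype.card d : ℝ) ≠ 0 := by exact_mod_cast Fintype.card_ne_zero
  simp [subsolutionEnergy, Finset.sum_const, Finset.card_univ, nsmul_eq_mul,
    mul_div_cancel₀ _ hcard]

/-- A smooth strict subsolution is in particular a velocity that is smooth in space at each time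
of `S` ("a smooth triple", §2.3). [cite: BurczakSzekelyhidiWu2023, §2.3 p. 17] -/
theorem IsSmoothStrictEulerSubsolutionOn.isSmooth_slice {S : Set ℝ}
    {u : ℝ → UnitAddTorus d → EuclideanSpace ℝ d} {p : ℝ → UnitAddTorus d → ℝ}
    {R : ℝ → UnitAddTorus d → d → EuclideanSpace ℝ d}
    (h : IsSmoothStrictEulerSubsolutionOn S u p R) {t : ℝ} (ht : t ∈ S) :
    FunctionSpaces.Torus.IsSmooth (u t) :=
  h.smooth_velocity.isSmooth_slice ht

end Torus

/-! ## Bookkeeping between the facts (proved) -/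

/-- Strong density with the zero solution `ū = 0` recovers the weak Euler solution of Thm. 1.1
(without any information on the energy profile): `strongDensity → thm11`. [cite: BurczakSzekelyhidiWu2023, §1.1 p. 2; Thm. 1.1 p. 2] -/
theorem BurczakSzekelyhidiWu2023_thm11_of_strongDensity
    (h : BurczakSzekelyhidiWu2023_strongDensity) : BurczakSzekelyhidiWu2023_thm11 := by
  intro T₀ hT₀ β hβ
  have hzero : FunctionSpaces.Torus.IsClassicalNSSolutionOn (d := Fin 3) (Icc 0 T₀) 0
      (fun _ _ => 0) (fun _ _ => 0) (fun _ _ => 0) :=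
    ⟨contDiffOn_const, contDiffOn_const, fun t _ x => by simp, fun t _ x => by simp⟩
  obtain ⟨u, hu, hH, -, κ, hκ⟩ := h T₀ hT₀ (fun _ _ => 0) (fun _ _ => 0) hzero
    (fun t _ => by simp [FunctionSpaces.Torus.HasZeroMean]) β hβ 1 one_pos
  exact ⟨u, hu, hH, κ, hκ⟩

/-- The trivial triple `(ū, p̄, R̄) = (0, 0, ⅓ Id)` is a smooth strict subsolution on any time set
(the one used on p. 19 to derive Thm. 1.1 from Thm. 3.1, with constant energy `e ≡ 1`).
[cite: BurczakSzekelyhidiWu2023, proof of Thm. 1.1 p. 19] -/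
theorem Torus.isSmoothStrictEulerSubsolutionOn_zero_third_id (S : Set ℝ) :
    Torus.IsSmoothStrictEulerSubsolutionOn (d := Fin 3) S (fun _ _ => 0) (fun _ _ => 0)
      (fun _ _ j => ((1 : ℝ) / Fintype.card (Fin 3)) • EuclideanSpace.single j (1 : ℝ)) where
  smooth_velocity := contDiffOn_const
  smooth_pressure := contDiffOn_const
  smooth_stress := contDiffOn_const
  momentum t _ x := by
    simp [Torus.tensorDivergence, FunctionSpaces.Torus.partialDeriv, FunctionSpaces.Torus.lineDeriv]
  divFree t _ x := by simp
  hasZeroMean_velocity _ _ := by simp [FunctionSpaces.Torus.HasZeroMean]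
  hasZeroMean_pressure _ _ := by simp [FunctionSpaces.Torus.HasZeroMean]
  symm _ _ _ i j := by
    rcases eq_or_ne i j with rfl | hij
    · rfl
    · simp [hij, hij.symm]
  uniformlyPosDef := by
    refine ⟨1 / 3, by norm_num, fun t _ x ξ => le_of_eq ?_⟩
    have hsum : ∑ j, ξ j * ⟪((1 : ℝ) / Fintype.card (Fin 3)) • EuclideanSpace.single j (1 : ℝ), ξ⟫_ℝ =
        (1 / 3) * ∑ j, ξ j * ξ j := by
      simp [real_inner_smul_left, EuclideanSpace.inner_single_left, Finset.mul_sum, mul_left_comm]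
    rw [hsum, EuclideanSpace.real_norm_sq_eq]
    simp [pow_two]

/-- Thm. 3.1 with the trivial subsolution `(0, 0, ⅓ Id)` (energy `e ≡ 1`) gives Thm. 1.1 — the
derivation printed on p. 19 ("Take `ū = 0`, `p̄ = 0` and `R̄ = ⅓ e(t) Id` for a strictly positive,
smooth function `e` (say, constant)"). [cite: BurczakSzekelyhidiWu2023, proof of Thm. 1.1 p. 19] -/
theorem BurczakSzekelyhidiWu2023_thm11_of_thm31 (h : BurczakSzekelyhidiWu2023_thm31) :
    BurczakSzekelyhidiWu2023_thm11 := by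
  intro T₀ hT₀ β hβ
  have he : ∀ t ∈ Icc (0 : ℝ) T₀, 0 < Torus.subsolutionEnergy (d := Fin 3) (fun _ _ => 0)
      (fun _ _ j => ((1 : ℝ) / Fintype.card (Fin 3)) • EuclideanSpace.single j (1 : ℝ)) t := by
    intro t _
    have h1 := Torus.subsolutionEnergy_zero_smul_id (d := Fin 3) (fun _ => (1 : ℝ)) t
    rw [h1]
    exact one_pos
  obtain ⟨u, hu, hH, -, κ, hκ⟩ :=
    h T₀ hT₀ _ _ _ (Torus.isSmoothStrictEulerSubsolutionOn_zero_third_id _) he β hβ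
  exact ⟨u, hu, hH, κ, hκ⟩

/-- **§1.2 (1.5) ⇒ Thm. 1.1** (Burczak–Székelyhidi–Wu, arXiv:2310.02934v2, p. 2: "for any
`0 < β < 1/3` there is `ε_β` such that for any `0 < ε < ε_β` the statement of Theorem 1.1 holds
with constant `c₀` satisfying `c₀ ≥ c_ε min{ℓ₀^{-2p_ε} ℓ_in^{2p_ε-2} T^{p_ε}, ℓ_in^{2ε}}` (1.5)"):
the data-uniform explicit bound `BurczakSzekelyhidiWu2023_richardsonBound` at `ε = ε_β/2` gives
the weak Euler solution `u ∈ C^β` and the sequence `κ_q → 0` of Thm. 1.1, and for each non-zero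
mean-zero `H¹` datum — which has a length scale `ℓ_in = ‖ρ_in‖_{L²}/‖∇ρ_in‖_{L²} > 0`
(`Torus.exists_lengthScale`: the spectral gradient norm of an `H¹` datum is finite, and positive
by the Poincaré inequality) — and each `T ∈ (0,T₀]` the per-datum constant
`c₀ = c_ε min{ℓ_in^{2p_ε-2} T^{p_ε}, ℓ_in^{2ε}} > 0` of `Torus.HasScalarAnomalousDissipationAlong`.
[cite: BurczakSzekelyhidiWu2023, §1.2 (1.5) p. 2; Thm. 1.1 (1.4) p. 2] -/
theorem BurczakSzekelyhidiWu2023_thm11_of_richardsonBound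
    (h : BurczakSzekelyhidiWu2023_richardsonBound) : BurczakSzekelyhidiWu2023_thm11 := by
  intro T₀ hT₀ β hβ
  obtain ⟨εβ, hεβ, hε⟩ := h T₀ hT₀ β hβ
  obtain ⟨u, hu, hH, κ, hκpos, hκlim, c, hc, hall⟩ :=
    hε (εβ / 2) (by positivity) (by linarith)
  refine ⟨u, hu, hH, κ, hκpos, hκlim, fun θ₀ hH1 hmean hpos T hT hTT₀ => ?_⟩
  obtain ⟨ℓ, hℓ, -, hid⟩ := Torus.exists_lengthScale hH1 hmean hpos
  refine ⟨_, ?_, hall θ₀ hH1 hmean hpos ℓ hℓ hid T hT hTT₀⟩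
  exact mul_pos hc (lt_min (mul_pos (Real.rpow_pos_of_pos hℓ _) (Real.rpow_pos_of_pos hT _))
    (Real.rpow_pos_of_pos hℓ _))

end Literature.Analysis.FluidPDE

end
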